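import Literature.Barriers.AtomisticToContinuum.HalfFillingInfraredModes
import Literature.Barriers.AtomisticToContinuum.HalfFillingGaussianDomination
import Literature.MathematicalPhysics.QuantumLattice.DuhamelTwoPointProofs
import HarnessLib

/-!
# Hard-core lattice bosons at half filling: the infrared bound (Aᵀ) and the proof of `HalfFillingReflectionPositivity`

`Literature/Barriers/AtomisticToContinuum`; sibling proof file of
`HalfFillingReflectionPositivity.lean` / `HalfFillingThermalKLS.lean`
(item `provefact-Literature.Barriers.AtomisticToContinuum.HalfFillingReflectionPositivity`). No statement is
introduced or changed. This file (i) carries out the transfer [LSSY2005] (11.8) ⇒ (11.22)–(11.23)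
at positive temperature for the Gibbs state of the hard-core lattice gas `H = H_XY + λF`
([LSSY2005] (11.2)) from thermal Gaussian domination in the form consumed by
`Matrix.gaussianDomination_duhamel_le` (`Z_β(H - V_h + ½Q(h)) ≤ Z_β(H)` for all real fields `h`,
`V_h = Σ(h_x - h_y)(S¹_x - S¹_y)`, `Q(h) = Σ(h_x - h_y)²`; [LSSY2005] (11.12), [DLS1978] Thm. 4.2,
proved in `HalfFillingGaussianDomination.lean` as `hc_partitionFn_field_le`), which discharges
(Aᵀ) `hc_infraredBound_thermal` (`hc_infraredBound_thermal_holds`); and (ii) assembles the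
**proof of the catalogued fact** `Literature.Barriers.AtomisticToContinuum.HalfFillingReflectionPositivity`
(`HalfFillingReflectionPositivity_holds`) from the six discharged facts (Aᵀ), (Bᵀ), (Cᵀ), (Dᵀ),
(Sᵀ), (Tᵀ) through `HalfFillingReflectionPositivity_of_facts` (`HalfFillingThermalKLS.lean`).
Part (i):

* Gaussian domination and `Matrix.gaussianDomination_duhamel_le_holds` ([DLS1978] (44)) give
  `(V_h, V_h) ≤ Q(h)/β`; for the waves `h = cos(q·), sin(q·)`, `V_h = 2E_q C_q, 2E_q D_q` and
  `Q(cos) + Q(sin) = 2E_q|Λ|`, so `(C_q,C_q) + (D_q,D_q) ≤ |Λ|/(2βE_q)` — the infrared bound (11.8);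
* the Falk–Bruch transfer `Matrix.falkBruch_sum_le_of_le` ([DLS1978] Thms. 3.1–3.2 with
  `coth x ≤ 1 + 1/x`, [LSSY2005] (11.22)–(11.23)) turns it into
  `⟨C²⟩ + ⟨D²⟩ ≤ b₀ + ½√(βb₀c)`, `b₀ = |Λ|/(2βE_q)`, `c = ⟨[C,[H,C]]⟩ + ⟨[D,[H,D]]⟩`;
* `|Λ|ĝ¹_q = ⟨C²⟩ + ⟨D²⟩` and `c ≤ 2|Λ|Σᵢ(e₁ - e₃cos qᵢ) + ½λ|Λ|` (`HalfFillingInfraredModes.lean`: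
  the double commutator (11.20), (Sᵀ), and the axis symmetry of the Gibbs state);

whence `0 ≤ ĝ¹_q ≤ 1/(2βE_q) + ½[(Σᵢ(e₁ - e₃cos qᵢ) + λ/4)/E_q]^{1/2}`, i.e. (Aᵀ) conditionally
on thermal Gaussian domination (`hc_infraredBound_thermal_of_gd`), hence unconditionally
(`hc_infraredBound_thermal_holds`).

Trust base of `HalfFillingReflectionPositivity_holds`: none beyond Mathlib (all six facts and
Gaussian domination are theorems of the tree; axioms `propext`, `Classical.choice`, `Quot.sound`).

## References

* [AizenmanEtAl2004] M. Aizenman, E. H. Lieb, R. Seiringer, J. P. Solovej, J. Yngvason,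
  *Bose–Einstein quantum phase transition in an optical lattice model*, Phys. Rev. A 70 (2004)
  023612.

* [LSSY2005] E. H. Lieb, R. Seiringer, J. P. Solovej, J. Yngvason, *The Mathematics of the Bose
  Gas and its Condensation* (2005), Ch. 11, (11.8)–(11.12), (11.20)–(11.23).
* [DLS1978] F. J. Dyson, E. H. Lieb, B. Simon, J. Stat. Phys. 18 (1978) 335–383, Thms. 3.1–3.2,
  4.2, eq. (44).
-/

noncomputable section

open Filter Topology Matrix Finset
open Literature.MathematicalPhysics.QuantumLattice Literature.MathematicalPhysics.QuantumLattice.SpinOperators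
  Literature.Probability.LatticeModels Literature.Probability.Percolation
open scoped ComplexOrder

namespace Literature.Barriers.AtomisticToContinuum.BoseGas

variable {d : ℕ}

/-! ### Bilinearity of the Duhamel two-point function -/

/-- `(aA, bB) = ab (A, B)` for the Duhamel two-point function. [cite: DLS1978, eq. (5)] -/
theorem duhamel_smul_smul {m : Type*} [Fintype m] [DecidableEq m] (β : ℝ) (H A B : Matrix m m ℂ)
    (a b : ℂ) : duhamel β H (a • A) (b • B) = a * b * duhamel β H A B := by
  unfold duhamel
  have key : ∀ s : ℝ, (a • A * gibbsWeight (s * β) H * (b • B) * gibbsWeight ((1 - s) * β) H).trace =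
      a * b * (A * gibbsWeight (s * β) H * B * gibbsWeight ((1 - s) * β) H).trace := by
    intro s
    simp only [Matrix.smul_mul, Matrix.mul_smul, trace_smul, smul_eq_mul]
    ring
  simp_rw [key]
  rw [intervalIntegral.integral_const_mul]
  ring

/-! ### (GD) ⇒ (Aᵀ) in finite volume -/

/-- **Thermal Gaussian domination ⇒ the infrared bound (Aᵀ), in finite volume.** For `d ≥ 1`,
side `L ≥ 3`, `β > 0`, `λ ≥ 0` and a momentum `q ≠ 0` of the dual torus: if
`Z_β(H - V_h + ½Q(h)) ≤ Z_β(H)` for every real field `h` (`H = hardCoreLatticeGas d L λ`), then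
`0 ≤ ĝ¹_q ≤ 1/(2βE_q) + ½[(Σᵢ(e₁ - e₃ cos qᵢ) + λ/4)/E_q]^{1/2}`.
[cite: LSSY2005, Ch. 11 (11.8), (11.12), (11.20)–(11.23)] [cite: DLS1978, Thms. 3.1–3.2, eq. (44)] -/
theorem hc_infraredBound_of_gd (L : ℕ) [NeZero L] (hL : 3 ≤ L) (hd : 0 < d) {β : ℝ} (hβ : 0 < β)
    {lam : ℝ} (hlam : 0 ≤ lam)
    (hGD : ∀ h : TorusSite d L → ℝ,
      (partitionFn β (hardCoreLatticeGas d L lam - xyGradField L 1 h +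
        ((xyFieldEnergy L h / 2 : ℝ) : ℂ) • 1)).re ≤ (partitionFn β (hardCoreLatticeGas d L lam)).re)
    (q : TorusSite d L) (hq : q ≠ 0) :
    0 ≤ hcStructureFactor 0 β L lam q ∧
      hcStructureFactor 0 β L lam q ≤
        1 / (2 * β * dispersion (latticeMomentum L q)) +
          1 / 2 * Real.sqrt (((∑ i, (hcBondCorr (d := d) 0 β L lam -
              hcBondCorr (d := d) 2 β L lam * Real.cos (latticeMomentum L q i))) + lam / 4) /
            dispersion (latticeMomentum L q)) := by
  -- notation
  set H : Op (TorusSite d L) 2 := hardCoreLatticeGas d L lam with hH_def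
  have hH : H.IsHermitian := hardCoreLatticeGas_isHermitian d L lam
  set E : ℝ := dispersion (latticeMomentum L q) with hE_def
  have hE : 0 < E := dispersion_latticeMomentum_pos hq
  set C : Op (TorusSite d L) 2 := xyCosMode L 1 q with hC_def
  set D : Op (TorusSite d L) 2 := xySinMode L 1 q with hD_def
  have hC : C.IsHermitian := xyCosMode_isHermitian L 1 q
  have hD : D.IsHermitian := xySinMode_isHermitian L 1 q
  have hLd : 0 < (L : ℝ) ^ d := by
    have : (0 : ℝ) < L := by exact_mod_cast Nat.pos_of_ne_zero (NeZero.ne L)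
    positivity
  set Sg : ℝ := ∑ i, (hcBondCorr (d := d) 0 β L lam -
    hcBondCorr (d := d) 2 β L lam * Real.cos (latticeMomentum L q i)) with hSg_def
  -- (1) the Duhamel infrared bound `(V_h, V_h) ≤ Q(h)/β` from Gaussian domination
  have hDuh : ∀ h : TorusSite d L → ℝ,
      (duhamel β H (xyGradField L 1 h) (xyGradField L 1 h)).re ≤ xyFieldEnergy L h / β := by
    intro h
    refine gaussianDomination_duhamel_le_holds _ β hβ H (xyGradField L 1 h) hH
      (xyGradField_isHermitian L 1 h) (xyFieldEnergy L h) (fun t => ?_)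
    have := hGD (t • h)
    rwa [xyGradField_smul, xyFieldEnergy_smul] at this
  -- (2) the two modes: `(C,C) + (D,D) ≤ |Λ|/(2βE)`
  set b₀ : ℝ := (L : ℝ) ^ d / (2 * β * E) with hb₀_def
  have hb₀ : 0 ≤ b₀ := by positivity
  have hmode : ∀ {W : Op (TorusSite d L) 2} {h : TorusSite d L → ℝ},
      xyGradField L 1 h = ((2 * E : ℝ) : ℂ) • W →
        (2 * E) ^ 2 * (duhamel β H W W).re ≤ xyFieldEnergy L h / β := by
    intro W h hVh
    have h1 := hDuh h
    rw [hVh, duhamel_smul_smul, show ((2 * E : ℝ) : ℂ) * ((2 * E : ℝ) : ℂ) = (((2 * E) ^ 2 : ℝ) : ℂ) by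
      push_cast; ring, Complex.re_ofReal_mul] at h1
    exact h1
  have hb : (duhamel β H C C).re + (duhamel β H D D).re ≤ b₀ := by
    have h1 := hmode (xyGradField_cos L 1 q)
    have h2 := hmode (xyGradField_sin L 1 q)
    have hQ := xyFieldEnergy_cos_add_sin L q
    rw [← hE_def] at hQ
    have h4E : (0 : ℝ) < (2 * E) ^ 2 := by positivity
    have hsum : (2 * E) ^ 2 * ((duhamel β H C C).re + (duhamel β H D D).re) ≤
        2 * E * (L : ℝ) ^ d / β := by
      rw [mul_add, ← hQ, add_div]
      exact add_le_add h1 h2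
    rw [hb₀_def, le_div_iff₀ (by positivity)]
    rw [le_div_iff₀ hβ] at hsum
    nlinarith [hsum, hE]
  -- (3) Falk–Bruch for the pair `(C, D)`
  have hA : ∀ k : Fin 2, ((![C, D] : Fin 2 → Op (TorusSite d L) 2) k).IsHermitian := by
    intro k
    fin_cases k
    · exact hC
    · exact hD
  have hFB := falkBruch_sum_le_of_le hH hβ.le hA (b₀ := b₀)
    (by simpa only [Fin.sum_univ_two, Matrix.cons_val_zero, Matrix.cons_val_one] using hb)
  simp only [Fin.sum_univ_two, Matrix.cons_val_zero, Matrix.cons_val_one] at hFB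
  -- (4) the two sides: `|Λ| ĝ` and the double commutator
  have hlhs : hcStructureFactor 0 β L lam q * (L : ℝ) ^ d =
      (gibbsState β H (C * C)).re + (gibbsState β H (D * D)).re := hcStructureFactor_eq_modes β L lam q
  set c : ℝ := (gibbsState β H (C * (H * C - C * H) - (H * C - C * H) * C)).re +
    (gibbsState β H (D * (H * D - D * H) - (H * D - D * H) * D)).re with hc_def
  have hc0 : 0 ≤ c := add_nonneg (hH.re_gibbsState_doubleComm_nonneg hC hβ.le)
    (hH.re_gibbsState_doubleComm_nonneg hD hβ.le)
  have hcle : c ≤ (L : ℝ) ^ d * (2 * Sg + lam / 2) := by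
    have h1 := re_gibbsState_doubleComm_modes_le β L hL hlam q
    have hS : ∀ z w : TorusSite d L, hcCorr 1 β L lam z w = hcCorr 0 β L lam z w :=
      fun z w => hc_corr_one_eq_zero_holds d L β lam z w
    have hdir : 2 * ∑ i : Fin d, ∑ z : TorusSite d L,
        (hcCorr 1 β L lam z (z + Pi.single i 1) -
          Real.cos (latticeMomentum L q i) * hcCorr 2 β L lam z (z + Pi.single i 1)) =
        (L : ℝ) ^ d * (2 * Sg) := by
      rw [hSg_def, mul_sum, mul_sum, mul_sum]
      refine sum_congr rfl fun i _ => ?_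
      simp only [hS]
      rw [sum_sub_distrib, ← mul_sum, sum_hcCorr_dir_eq_bondCorr β L lam hd 0 i,
        sum_hcCorr_dir_eq_bondCorr β L lam hd 2 i]
      ring
    rw [hdir] at h1
    calc c ≤ (L : ℝ) ^ d * (2 * Sg) + lam * ((L : ℝ) ^ d / 2) := h1
      _ = (L : ℝ) ^ d * (2 * Sg + lam / 2) := by ring
  -- (5) positivity of `ĝ`
  have haC : 0 ≤ (gibbsState β H (C * C)).re := re_gibbsState_mul_self_nonneg β L lam hC
  have haD : 0 ≤ (gibbsState β H (D * D)).re := re_gibbsState_mul_self_nonneg β L lam hD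
  have hg0 : 0 ≤ hcStructureFactor 0 β L lam q := by
    have h0 : 0 ≤ hcStructureFactor 0 β L lam q * (L : ℝ) ^ d := by rw [hlhs]; exact add_nonneg haC haD
    exact nonneg_of_mul_nonneg_left h0 hLd
  refine ⟨hg0, ?_⟩
  -- (6) assemble: `|Λ|ĝ ≤ b₀ + ½√(βb₀c) ≤ b₀ + ½ |Λ| √((Sg + λ/4)/E)`
  have hsqrt : Real.sqrt (β * b₀ * c) ≤ (L : ℝ) ^ d * Real.sqrt ((Sg + lam / 4) / E) := by
    have h1 : β * b₀ * c ≤ ((L : ℝ) ^ d) ^ 2 * ((Sg + lam / 4) / E) := by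
      calc β * b₀ * c ≤ β * b₀ * ((L : ℝ) ^ d * (2 * Sg + lam / 2)) :=
            mul_le_mul_of_nonneg_left hcle (by positivity)
        _ = ((L : ℝ) ^ d) ^ 2 * ((Sg + lam / 4) / E) := by
            rw [hb₀_def]
            field_simp
            ring
    calc Real.sqrt (β * b₀ * c) ≤ Real.sqrt (((L : ℝ) ^ d) ^ 2 * ((Sg + lam / 4) / E)) :=
          Real.sqrt_le_sqrt h1
      _ = (L : ℝ) ^ d * Real.sqrt ((Sg + lam / 4) / E) := by
          rw [Real.sqrt_mul (sq_nonneg _), Real.sqrt_sq hLd.le]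
  have hmain : hcStructureFactor 0 β L lam q * (L : ℝ) ^ d ≤
      b₀ + 1 / 2 * ((L : ℝ) ^ d * Real.sqrt ((Sg + lam / 4) / E)) := by
    rw [hlhs]
    calc (gibbsState β H (C * C)).re + (gibbsState β H (D * D)).re
        ≤ b₀ + 1 / 2 * Real.sqrt (β * b₀ * c) := hFB
      _ ≤ b₀ + 1 / 2 * ((L : ℝ) ^ d * Real.sqrt ((Sg + lam / 4) / E)) := by gcongr
  have hb₀' : b₀ = (L : ℝ) ^ d * (1 / (2 * β * E)) := by rw [hb₀_def]; ring
  rw [hb₀'] at hmain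
  have hfin : hcStructureFactor 0 β L lam q * (L : ℝ) ^ d ≤
      (1 / (2 * β * E) + 1 / 2 * Real.sqrt ((Sg + lam / 4) / E)) * (L : ℝ) ^ d := by
    calc hcStructureFactor 0 β L lam q * (L : ℝ) ^ d
        ≤ (L : ℝ) ^ d * (1 / (2 * β * E)) + 1 / 2 * ((L : ℝ) ^ d * Real.sqrt ((Sg + lam / 4) / E)) :=
          hmain
      _ = (1 / (2 * β * E) + 1 / 2 * Real.sqrt ((Sg + lam / 4) / E)) * (L : ℝ) ^ d := by ring
  exact le_of_mul_le_mul_right hfin hLd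

/-- **Thermal Gaussian domination ⇒ (Aᵀ).** If for every even torus `(ℤ/2kℤ)^d`, `k ≥ 2`, every
`β > 0`, `λ ≥ 0` and every real field `h`, `Z_β(H - V_h + ½Q(h)) ≤ Z_β(H)` for the hard-core
lattice gas `H` ([LSSY2005] (11.12); [DLS1978] Thm. 4.2), then the thermal infrared bound
`hc_infraredBound_thermal` holds. [cite: LSSY2005, Ch. 11 (11.8), (11.12), (11.20)–(11.23)]
[cite: DLS1978, Thms. 3.1–3.2, Lemma 4.1, Thm. 4.2, eq. (44)] -/
theorem hc_infraredBound_thermal_of_gd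
    (hGD : ∀ (d k : ℕ) [NeZero (2 * k)], 2 ≤ k → ∀ (β lam : ℝ), 0 < β → 0 ≤ lam →
      ∀ h : TorusSite d (2 * k) → ℝ,
        (partitionFn β (hardCoreLatticeGas d (2 * k) lam - xyGradField (2 * k) 1 h +
          ((xyFieldEnergy (2 * k) h / 2 : ℝ) : ℂ) • 1)).re ≤
          (partitionFn β (hardCoreLatticeGas d (2 * k) lam)).re) :
    hc_infraredBound_thermal := by
  intro d hd k hk β lam hβ hlam q hq
  haveI : NeZero (2 * k) := ⟨by omega⟩
  exact hc_infraredBound_of_gd (2 * k) (by omega) (by omega) hβ hlam (hGD d k hk β lam hβ hlam) q hq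

/-- **Discharge of (Aᵀ)** `hc_infraredBound_thermal`: the thermal infrared bound for the
hard-core lattice gas at half filling, from Gaussian domination at positive temperature
(`hc_partitionFn_field_le`, [LSSY2005] (11.12), [DLS1978] Thm. 4.2) and the transfer
`hc_infraredBound_thermal_of_gd` ([LSSY2005] (11.8), (11.20)–(11.23); [DLS1978] Thms. 3.1–3.2,
eq. (44)). [cite: LSSY2005, Ch. 11 (11.8), (11.12), (11.20)–(11.23)]
[cite: DLS1978, Thms. 3.1–3.2, Lemma 4.1, Thm. 4.2, eq. (44)] -/
theorem hc_infraredBound_thermal_holds : hc_infraredBound_thermal := by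
  refine hc_infraredBound_thermal_of_gd ?_
  intro d k _ hk β lam hβ _hlam h
  exact hc_partitionFn_field_le (2 * k) (even_two_mul k) (by omega) hβ lam h

end Literature.Barriers.AtomisticToContinuum.BoseGas

namespace Literature.Barriers.AtomisticToContinuum

open BoseGas

/-- **Proof of the catalogued fact `HalfFillingReflectionPositivity`** (BEC = off-diagonal
long-range order for hard-core lattice bosons at half filling in a small staggered field, on the
even tori `(ℤ/2kℤ)^d`, `d ≥ 3`, at low temperature; Aizenman–Lieb–Seiringer–Solovej–Yngvason 2004,
[LSSY2005] Ch. 11 (11.26)): the assembly `HalfFillingReflectionPositivity_of_facts`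
(`HalfFillingThermalKLS.lean`; [LSSY2005] (11.22)–(11.27) in the Kennedy–Lieb–Shastry arrangement)
applied to the discharged facts (Aᵀ) `hc_infraredBound_thermal_holds` (reflection positivity /
Gaussian domination via the Dyson–Lieb–Simon trace inequality, the Duhamel infrared bound and the
Falk–Bruch transfer), (Bᵀ) `hc_kubo_thermal_holds`, (Cᵀ) `hc_sumRule_holds`,
(Dᵀ) `hc_bondCorr_lower_thermal_holds`, (Sᵀ) `hc_corr_one_eq_zero_holds`, (Tᵀ) `hc_corr_abs_le_holds`.
[cite: LSSY2005, Ch. 11 §11.3 (11.26)] [cite: AizenmanEtAl2004] -/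
theorem HalfFillingReflectionPositivity_holds : HalfFillingReflectionPositivity :=
  HalfFillingReflectionPositivity_of_facts hc_infraredBound_thermal_holds hc_kubo_thermal_holds
    hc_sumRule_holds hc_bondCorr_lower_thermal_holds hc_corr_one_eq_zero_holds hc_corr_abs_le_holds

end Literature.Barriers.AtomisticToContinuum
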